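import Summits.AnomalousDissipation.AnomalousDissipation.Theorems.WindLineWindyGalerkinSteadyZerothLawGenericLeafNondegeneracyOpen
import Summits.AnomalousDissipation.AnomalousDissipation.Theorems.WindLineWindyGalerkinSteadyZerothLawGenericLeafNondegeneracyToolsF
import Summits.AnomalousDissipation.AnomalousDissipation.Theorems.WindLineWindyGalerkinSteadyZerothLawGenericLeafNondegeneracyToolsG
import Summits.AnomalousDissipation.AnomalousDissipation.Theorems.WindLineWindyGalerkinSteadyZerothLawTruncationOnW

/-!
# Generic leaf-nondegeneracy (stub B of crux `WindLine.WindyGalerkinSteadyZerothLaw`,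
# stmt-AnomalousDissipation-11414), tools I: finite-mode transversality, uniformly near a compact set

Helper layer (pure proof file, no definitions), lattice vocabulary of tools B–D.  With the Fourier
truncations `P_N : W →L W` of the landed `stub_truncationOnW` and the lattice linearisation
`T(x) = 4π²ν + (D + K_x)`, `K_x w = B(x,w) + B(w,x)`:

* `trunc_trunc_of_le`, `monotone_range_trunc` — `P_M P_N = P_N` for `N ≤ M`, so the ranges increase;
* `linearisation_eq`, `isCompactOperator_drift_add_linOp` — at a point with rapidly decaying physical
  coefficients, `T(x)` is `4π²ν·1 + compact`, so tools E/F apply (finite-dimensional kernel, closed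
  range with a complement of the same dimension);
* `exists_stage` — **finite-mode transversality at a point**: `range T(x) + range P_N = W` for some `N`
  (tools G, `exists_sup_range_eq_top`);
* `exists_uniform_stage` — **uniformly near a compact set** `Σ` of such points: one `N` and an open
  `U ⊇ Σ` with `(ξ, η) ↦ T(x) ξ + P_N η` onto for every `x ∈ U` (continuity of `x ↦ T(x)`, openness of
  surjectivity `exists_surjective_nhds`, finite subcover).

References: Foias–Temam, LNM 565 (1976), p. 26; Saut–Temam, Comm. PDE 4 (1979), §2.
-/

noncomputable section

-- D-0017: single-problem summit ⇒ the duplicated namespace segment is by design.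
set_option linter.dupNamespace false

open scoped BigOperators Topology ENNReal NNReal InnerProductSpace ComplexConjugate
open Filter Set Function TopologicalSpace MeasureTheory UnitAddTorus
open Literature.Analysis.FunctionSpaces Literature.Analysis.FunctionSpaces.Torus
open Literature.Analysis.FunctionSpaces.EuclideanSpace
open Literature.Analysis.FluidPDE Literature.Analysis.FluidPDE.Torus
open Literature.Analysis.FluidPDE.ScalarFourier
open Literature.Analysis.FluidPDE.SteadyLattice Literature.Analysis.FluidPDE.SteadyLatticeDrift

namespace Summit.AnomalousDissipation.AnomalousDissipation.Theorems.WindLineWindyGalerkinSteadyZerothLaw.GenericLeaf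

/-- Complex coefficient vectors (local notation). -/
local notation "ℂ³" => EuclideanSpace ℂ (Fin 3)
/-- Square-summable coefficient families `ℤ³ → ℂ³` (local notation). -/
local notation "ℓ2" => lp (fun _ : Fin 3 → ℤ => EuclideanSpace ℂ (Fin 3)) 2
/-- Physical coefficients `x̌(k) = x(k)/|k|²` of a family (local notation, the tree's `cf`). -/
local notation "cf[" X "]" =>
  ((fun mm : Fin 3 → ℤ => (((freqNormSq mm)⁻¹ : ℝ) : ℂ)) • (X : (Fin 3 → ℤ) → EuclideanSpace ℂ (Fin 3)))
/-- `k · v = ∑ⱼ kⱼ vⱼ` (local notation, the tree's `kdot`). -/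
local notation "kdot[" k "," v "]" =>
  (∑ jj : Fin 3, (((k : Fin 3 → ℤ) jj : ℤ) : ℂ) * (v : EuclideanSpace ℂ (Fin 3)) jj)
/-- The convective symbol `N(a, b)(k)` as a vector of `ℂ³` (local notation, the tree's `nl`). -/
local notation "nl[" a "," b "," k "]" =>
  ((WithLp.toLp 2 (fun pp : Fin 3 => transportSym (fun jj mm => (a : (Fin 3 → ℤ) → EuclideanSpace ℂ (Fin 3)) mm jj)
    (fun mm => (b : (Fin 3 → ℤ) → EuclideanSpace ℂ (Fin 3)) mm pp) k)) : EuclideanSpace ℂ (Fin 3))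

section Generic

variable {E F : Type*} [NormedAddCommGroup E] [NormedSpace ℝ E] [CompleteSpace E]
  [NormedAddCommGroup F] [NormedSpace ℝ F] [CompleteSpace F]

/-- Filter form of the openness of surjectivity (tools G): surjective maps form a neighbourhood of a
surjective map. [folklore] -/
theorem eventually_surjective (A : E →L[ℝ] F) (hA : Function.Surjective A) :
    ∀ᶠ A' : E →L[ℝ] F in 𝓝 A, Function.Surjective (A' : E → F) := by
  obtain ⟨δ, hδ, h⟩ := exists_surjective_nhds A hA
  filter_upwards [Metric.ball_mem_nhds A hδ] with A' hA'
  exact h A' (by rwa [Metric.mem_ball, dist_eq_norm] at hA')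

end Generic

section Transversality

variable {W : Submodule ℝ ℓ2}
variable (hWc : IsClosed (W : Set ℓ2))
variable (B : W → W → W)
variable (hB : ∀ x y : W, (((B x y : W) : ℓ2) : (Fin 3 → ℤ) → ℂ³) = fun k =>
  lerayCoeff k nl[cf[((x : ℓ2) : (Fin 3 → ℤ) → ℂ³)], cf[((y : ℓ2) : (Fin 3 → ℤ) → ℂ³)], k])
variable (hBb : IsBoundedBilinearMap ℝ (fun p : W × W => B p.1 p.2))
variable (D : W →L[ℝ] W) (hDc : IsCompactOperator D)
variable (P : ℕ → W →L[ℝ] W)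
variable (hP : ∀ (N : ℕ) (x : W) (k : Fin 3 → ℤ),
  (((P N x : W) : ℓ2) : (Fin 3 → ℤ) → ℂ³) k = if k ∈ freqBall N then ((x : ℓ2) : (Fin 3 → ℤ) → ℂ³) k else 0)
variable (hPlim : ∀ x : W, Tendsto (fun N => P N x) atTop (𝓝 x))

/-! ## §1 The truncations have increasing ranges -/

include hP in
/-- `P_M (P_N x) = P_N x` for `N ≤ M`. [folklore] -/
theorem trunc_trunc_of_le {N M : ℕ} (hNM : N ≤ M) (x : W) : P M (P N x) = P N x := by
  refine Subtype.ext (lp.ext (funext fun k => ?_))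
  rw [hP, hP]
  by_cases hk : k ∈ freqBall N
  · rw [if_pos (freqBall_mono hNM hk), if_pos hk]
  · rw [if_neg hk]
    split_ifs <;> rfl

include hP in
/-- The ranges of the truncations increase with `N`. [folklore] -/
theorem monotone_range_trunc : Monotone fun N => LinearMap.range ((P N : W →L[ℝ] W) : W →ₗ[ℝ] W) := by
  intro N M hNM y hy
  obtain ⟨x, rfl⟩ := hy
  exact ⟨P N x, trunc_trunc_of_le P hP hNM x⟩

/-! ## §2 The linearisation at a point with rapidly decaying coefficients -/

/-- The linearisation `T(x) = c·1 + (D + K_x)` applied. [folklore] -/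
theorem linearisation_eq (c : ℝ) (x w : W) :
    (c • ContinuousLinearMap.id ℝ W +
        (D + (hBb.deriv (x, x)).comp ((ContinuousLinearMap.id ℝ W).prod (ContinuousLinearMap.id ℝ W)))) w =
      c • w + (D + (hBb.deriv (x, x)).comp ((ContinuousLinearMap.id ℝ W).prod (ContinuousLinearMap.id ℝ W))) w :=
  linearisation_apply B hBb D c x w

include hWc hB hDc in
/-- **At a point with rapidly decaying physical coefficients, `D + K_x` is compact**
(`SteadyLattice.isCompactOperator_linearised`). [folklore] -/
theorem isCompactOperator_drift_add_linOp (x : W) (hx : RapidDecay cf[((x : ℓ2) : (Fin 3 → ℤ) → ℂ³)]) :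
    IsCompactOperator (D + (hBb.deriv (x, x)).comp ((ContinuousLinearMap.id ℝ W).prod (ContinuousLinearMap.id ℝ W))) :=
  hDc.add (isCompactOperator_linearised hWc hB x hx _ (linOp_apply B hBb x))

/-! ## §3 Finite-mode transversality at a point -/

include hWc hB hDc hP hPlim in
/-- **Finite-mode transversality at a point**: for `x ∈ W` with rapidly decaying physical
coefficients and `c ≠ 0`, `range T(x) + range P_N = W` for some `N` (index zero of
`T(x) = c + compact`, tools F, and the finite-stage lemma of tools G). [folklore] -/
theorem exists_stage [CompleteSpace W] {c : ℝ} (hc : c ≠ 0) (x : W)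
    (hx : RapidDecay cf[((x : ℓ2) : (Fin 3 → ℤ) → ℂ³)]) :
    ∃ N, LinearMap.range ((c • ContinuousLinearMap.id ℝ W +
        (D + (hBb.deriv (x, x)).comp ((ContinuousLinearMap.id ℝ W).prod (ContinuousLinearMap.id ℝ W))) : W →L[ℝ] W) :
          W →ₗ[ℝ] W) ⊔ LinearMap.range ((P N : W →L[ℝ] W) : W →ₗ[ℝ] W) = ⊤ := by
  obtain ⟨-, hRc, C', hC'fd, hC'compl, -⟩ := exists_isCompl_range_finrank_eq
    (isCompactOperator_drift_add_linOp hWc B hB hBb D hDc x hx) hc (linearisation_eq B hBb D c x)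
  haveI := hC'fd
  exact exists_sup_range_eq_top _ C' hRc hC'compl P (monotone_range_trunc P hP) hPlim

/-! ## §4 Uniformly near a compact set -/

-- the operator-norm instances on `W × W →L[ℝ] W` (`W` a subtype of `ℓ²`) are expensive to synthesise
set_option synthInstance.maxHeartbeats 160000 in
set_option maxHeartbeats 800000 in
include hWc hB hDc hP hPlim in
/-- **Uniform finite-mode transversality near a compact set.**  If `Σ ⊆ W` is compact and every point
of `Σ` has rapidly decaying physical coefficients, then there are `N` and an open `U ⊇ Σ` such that
for every `x ∈ U` the map `(ξ, η) ↦ T(x) ξ + P_N η` is onto `W`. [folklore] -/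
theorem exists_uniform_stage [CompleteSpace W] {c : ℝ} (hc : c ≠ 0) (S : Set W) (hS : IsCompact S)
    (hSr : ∀ x ∈ S, RapidDecay cf[((x : ℓ2) : (Fin 3 → ℤ) → ℂ³)]) :
    ∃ (N : ℕ) (U : Set W), IsOpen U ∧ S ⊆ U ∧ ∀ x ∈ U, ∀ y : W, ∃ ξ η : W,
      (c • ContinuousLinearMap.id ℝ W +
        (D + (hBb.deriv (x, x)).comp ((ContinuousLinearMap.id ℝ W).prod (ContinuousLinearMap.id ℝ W)))) ξ + P N η = y := by
  -- the operators `A N x = [T x, P N]`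
  obtain ⟨T, hT⟩ : ∃ T : W → (W →L[ℝ] W), T = fun x => c • ContinuousLinearMap.id ℝ W +
      (D + (hBb.deriv (x, x)).comp ((ContinuousLinearMap.id ℝ W).prod (ContinuousLinearMap.id ℝ W))) := ⟨_, rfl⟩
  have hTc : Continuous T := by rw [hT]; exact continuous_linearisation B hBb D c
  obtain ⟨A, hA⟩ : ∃ A : ℕ → W → (W × W →L[ℝ] W), A = fun N x => (T x).coprod (P N) := ⟨_, rfl⟩
  have hAx : ∀ N x ξ η, A N x (ξ, η) = T x ξ + P N η := fun N x ξ η => by rw [hA]; rfl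
  have hAc : ∀ N, Continuous (A N) := by
    intro N
    have e : A N = fun x => (T x).comp (ContinuousLinearMap.fst ℝ W W) + (P N).comp (ContinuousLinearMap.snd ℝ W W) := by
      funext x
      rw [hA]
      exact ContinuousLinearMap.ext fun p => by simp
    rw [e]
    refine Continuous.add ?_ continuous_const
    exact (isBoundedBilinearMap_comp (𝕜 := ℝ) (E := W × W) (F := W) (G := W)).continuous.comp
      (hTc.prodMk continuous_const)
  -- pointwise data on `S`: a stage and a radius of surjectivity
  have hpt : ∀ x ∈ S, ∃ (N : ℕ) (V : Set (W × W →L[ℝ] W)), IsOpen V ∧ A N x ∈ V ∧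
      ∀ A' : W × W →L[ℝ] W, A' ∈ V → Function.Surjective (A' : W × W → W) := by
    intro x hx
    obtain ⟨N, hN⟩ := exists_stage hWc B hB hBb D hDc P hP hPlim hc x (hSr x hx)
    have hsurj : Function.Surjective (A N x) := by
      intro y
      have hy : y ∈ LinearMap.range ((T x : W →L[ℝ] W) : W →ₗ[ℝ] W) ⊔ LinearMap.range ((P N : W →L[ℝ] W) : W →ₗ[ℝ] W) := by
        have e : T x = c • ContinuousLinearMap.id ℝ W +
            (D + (hBb.deriv (x, x)).comp ((ContinuousLinearMap.id ℝ W).prod (ContinuousLinearMap.id ℝ W))) := by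
          rw [hT]
        rw [e, hN]; trivial
      obtain ⟨a, ⟨ξ, rfl⟩, b, ⟨η, rfl⟩, rfl⟩ := Submodule.mem_sup.1 hy
      exact ⟨(ξ, η), hAx N x ξ η⟩
    obtain ⟨V, hVs, hVo, hxV⟩ := eventually_nhds_iff.1 (eventually_surjective (A N x) hsurj)
    exact ⟨N, V, hVo, hxV, fun A' hA' => hVs A' hA'⟩
  choose! Nx Vx hVo hxV hsx using hpt
  -- finite subcover of the compact `S`
  set Ux : W → Set W := fun x => (A (Nx x)) ⁻¹' Vx x with hUx
  have hUo : ∀ x ∈ S, IsOpen (Ux x) := fun x hx => (hAc (Nx x)).isOpen_preimage _ (hVo x hx)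
  have hcov : S ⊆ ⋃ x ∈ S, Ux x := fun x hx => mem_iUnion₂.2 ⟨x, hx, hxV x hx⟩
  obtain ⟨t, htS, htfin, htcov⟩ := hS.elim_finite_subcover_image hUo hcov
  -- the uniform stage and the open set
  set N₀ : ℕ := htfin.toFinset.sup Nx with hN₀
  refine ⟨N₀, ⋃ x ∈ t, Ux x, isOpen_biUnion fun x hx => hUo x (htS hx), htcov, fun x' hx' y => ?_⟩
  obtain ⟨x, hxt, hx'U⟩ := mem_iUnion₂.1 hx'
  have hsj : Function.Surjective (A (Nx x) x') := hsx x (htS hxt) (A (Nx x) x') hx'U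
  obtain ⟨⟨ξ, η⟩, hξη⟩ := hsj y
  rw [hAx] at hξη
  have hle : Nx x ≤ N₀ := Finset.le_sup (htfin.mem_toFinset.2 hxt)
  refine ⟨ξ, P (Nx x) η, ?_⟩
  rw [trunc_trunc_of_le P hP hle]
  have e : c • ContinuousLinearMap.id ℝ W +
      (D + (hBb.deriv (x', x')).comp ((ContinuousLinearMap.id ℝ W).prod (ContinuousLinearMap.id ℝ W))) = T x' := by
    rw [hT]
  rw [e]
  exact hξη

end Transversality

/-! ## §5 Registered sub-goal -/

/-- **Registered sub-goal `genericLeaf_toolsI`** (worker B of stub `stub_genericLeafNondegeneracy`):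
uniform finite-mode transversality near a compact set of points with rapidly decaying coefficients,
`exists_uniform_stage` in Pi-form. [folklore] -/
theorem genericLeaf_toolsI : ∀ (W : Submodule ℝ ℓ2), IsClosed (W : Set ℓ2) → ∀ (B : W → W → W), (∀ x y : W, (((B x y : W) : ℓ2) : (Fin 3 → ℤ) → ℂ³) = fun k => lerayCoeff k nl[cf[((x : ℓ2) : (Fin 3 → ℤ) → ℂ³)], cf[((y : ℓ2) : (Fin 3 → ℤ) → ℂ³)], k]) → ∀ (hBb : IsBoundedBilinearMap ℝ (fun p : W × W => B p.1 p.2)) (D : W →L[ℝ] W), IsCompactOperator D → ∀ (P : ℕ → W →L[ℝ] W), (∀ (N : ℕ) (x : W) (k : Fin 3 → ℤ), (((P N x : W) : ℓ2) : (Fin 3 → ℤ) → ℂ³) k = if k ∈ freqBall N then ((x : ℓ2) : (Fin 3 → ℤ) → ℂ³) k else 0) → (∀ x : W, Tendsto (fun N => P N x) atTop (𝓝 x)) → ∀ [CompleteSpace W] (c : ℝ), c ≠ 0 → ∀ (S : Set W), IsCompact S → (∀ x ∈ S, RapidDecay cf[((x : ℓ2) : (Fin 3 → ℤ) → ℂ³)])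 → ∃ (N : ℕ) (U : Set W), IsOpen U ∧ S ⊆ U ∧ ∀ x ∈ U, ∀ y : W, ∃ ξ η : W, (c • ContinuousLinearMap.id ℝ W + (D + (hBb.deriv (x, x)).comp ((ContinuousLinearMap.id ℝ W).prod (ContinuousLinearMap.id ℝ W)))) ξ + P N η = y :=
  fun _ hWc B hB hBb D hDc P hP hPlim _ _ hc S hS hSr => exists_uniform_stage hWc B hB hBb D hDc P hP hPlim hc S hS hSr

end Summit.AnomalousDissipation.AnomalousDissipation.Theorems.WindLineWindyGalerkinSteadyZerothLaw.GenericLeaf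

end
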